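import Summits.HodgeConjecture.CorCM.Census.MultiFieldWeilPureSlot
import HarnessLib

/-!
# MULTI-FIELD WEIL, census part 7: DESIGN SEPARATION — the translates of ANY proper position set under a 2-TRANSITIVE group of pure tuples separate (Fisher-type
# double counting), and peeling a slot of ANY size by a SET of pure tuples

COR-CM (cell `pub-hodgecm2`), seat b30 gen 30 (2026-08-24); count-neutral own lane MULTI-FIELD WEIL ENGINE (stem `MultiFieldWeil*`), sequel of census parts 4–6
(`Census/MultiFieldWeilSetTransitive`, `…PrimeRotations`, `…PureSlot`).  Theorems of the finite model only; no definition, no named fact, no `sorry`, no `decide`.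
`HC_CM` is NOT asserted anywhere (nothing Hodge-theoretic is stated in this file).

THE MECHANISM (the composite-size analogue of the prime rotation).  Part 6 peels a slot `m₀` by ONE pure tuple `ρ` and its powers; for a slot of PRIME size an `ℓ`-cycle
separates every proper position set by cyclotomy (part 5).  For a slot of ARBITRARY size `n` take instead the whole SET `H ⊆ R` of tuples that are the identity on the
live slots `M`: the signed equations at `π₀ ρ`, `ρ ∈ H`, say that `Q ↦ Σ_{a ∈ Q} d_{m₀}(a)` takes the same value on all translates `((π₀)_{m₀} ρ_{m₀})⁻¹ P`
(**`const_of_signed_pureSet_on`**).  If `H` is closed under products and inverses and acts 2-TRANSITIVELY on the points of the slot, these translates form a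
2-design with `r > λ` (`0 < |P| < n`), and Fisher-type double counting `Σ_{ρ : ρa ∈ Q₀} Σ_{b : ρ b ∈ Q₀} f(b) = r·f(a) + λ·(F − f(a)) = r·c` forces `f` constant
(**`sep_of_twoTransitive_translates`**; the counts `r`, `λ` are constant by the bijections `ρ ↦ ρ g`, **`card_filter_apply_mem_eq`**, **`card_filter_apply_mem_and_eq`**).
Use: a field whose `τ`-embeddings are moved 2-transitively by automorphisms of `ℂ/k` fixing the live fields (e.g. a generic CM field, Galois closure with full symmetric
group, linearly disjoint from the others) is peeled WHATEVER its degree and type.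
[cite: DixonMortimer1996, §2.1] [cite: MoonenZarhin1995Duke, Thm. 2.4] [cite: GaoUllmo2025, Thm 3.1]

## References
* [DixonMortimer1996] J. D. Dixon, B. Mortimer, *Permutation Groups*, GTM 163, §2.1 (2-transitive groups; orbit counting).  [MoonenZarhin1995Duke] B. Moonen,
  Yu. Zarhin, Duke Math. J. 77 (1995), Thm. 2.4.  [GaoUllmo2025] Z. Gao, E. Ullmo, J. Inst. Math. Jussieu 25 (2025), Thm 3.1.
-/

namespace Summit.HodgeConjecture.CorCM.Census.MultiFieldWeil

open Finset

variable {r : ℕ} {n : Fin r → ℕ} {R : Finset (PermsG n)} {P : ∀ m : Fin r, Finset (Fin (n m))}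

/-! ### Peeling a slot by a set of pure tuples -/

/-- **PEELING ONE SLOT BY A SET OF TUPLES PURE ON THE LIVE SLOTS.**  `R` closed under products, `π₀ ∈ R`, `H ⊆ R` a set of tuples that are the identity on `M`; every slot
outside `M ∪ {m₀}` has constant defect already.  If the sums of a function through the translates `((π₀)_{m₀} ρ_{m₀})⁻¹(P m₀)`, `ρ ∈ H`, being all equal to the sum through
`(π₀)_{m₀}⁻¹(P m₀)` forces the function to be constant (`hsep`), then `d_{m₀}` is constant for every solution of the signed equations.  The set form of
`const_of_signed_pure_on`. [cite: MoonenZarhin1995Duke, Thm. 2.4] [cite: GaoUllmo2025, Thm 3.1] -/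
theorem const_of_signed_pureSet_on (hmul : ∀ π ∈ R, ∀ π' ∈ R, π * π' ∈ R) {m₀ : Fin r} (M : Finset (Fin r)) (H : Finset (PermsG n))
    (hH : ∀ ρ ∈ H, ρ ∈ R ∧ ∀ m ∈ M, ρ m = 1) {π₀ : PermsG n} (hπ₀ : π₀ ∈ R)
    (hsep : ∀ f : Fin (n m₀) → ℤ, (∀ ρ ∈ H, ∑ a ∈ preG (π₀ m₀ * ρ m₀) (P m₀), f a = ∑ a ∈ preG (π₀ m₀) (P m₀), f a) → ∀ a b : Fin (n m₀), f a = f b)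
    {e : ℤ} {d : ∀ m : Fin r, Fin (n m) → ℤ} (hout : ∀ m, m ∉ M → m ≠ m₀ → ∀ a b : Fin (n m), d m a = d m b)
    (h : ∀ π ∈ R, e + ∑ m : Fin r, ∑ a : Fin (n m), (if π m a ∈ P m then d m a else -d m a) = 0) :
    ∀ a b : Fin (n m₀), d m₀ a = d m₀ b := by
  classical
  refine hsep (d m₀) fun ρ hρ => ?_
  have hj := h _ (hmul π₀ hπ₀ ρ (hH ρ hρ).1)
  have h0 := h _ hπ₀
  have hsplit : ∀ π : PermsG n, (∑ m : Fin r, ∑ a : Fin (n m), (if π m a ∈ P m then d m a else -d m a)) =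
      (∑ a : Fin (n m₀), (if π m₀ a ∈ P m₀ then d m₀ a else -d m₀ a)) +
        ∑ m ∈ univ.erase m₀, ∑ a : Fin (n m), (if π m a ∈ P m then d m a else -d m a) := fun π =>
    (Finset.add_sum_erase univ (fun m => ∑ a : Fin (n m), (if π m a ∈ P m then d m a else -d m a)) (Finset.mem_univ m₀)).symm
  have hrest : (∑ m ∈ univ.erase m₀, ∑ a : Fin (n m), (if (π₀ * ρ) m a ∈ P m then d m a else -d m a)) =
      ∑ m ∈ univ.erase m₀, ∑ a : Fin (n m), (if π₀ m a ∈ P m then d m a else -d m a) := by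
    refine Finset.sum_congr rfl fun m hm => ?_
    by_cases hmM : m ∈ M
    · rw [Pi.mul_apply, (hH ρ hρ).2 m hmM, mul_one]
    · have hmc := hout m hmM (Finset.ne_of_mem_erase hm)
      by_cases hm0 : 0 < n m
      · rw [Finset.sum_congr rfl fun a _ => by rw [hmc a ⟨0, hm0⟩], sum_ite_mem_const,
          Finset.sum_congr rfl fun a _ => by rw [hmc a ⟨0, hm0⟩], sum_ite_mem_const]
      · rw [Finset.sum_eq_zero fun a _ => absurd a.2 (by have := Nat.eq_zero_of_not_pos hm0; omega),
          Finset.sum_eq_zero fun a _ => absurd a.2 (by have := Nat.eq_zero_of_not_pos hm0; omega)]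
  have hm₀ : (π₀ * ρ) m₀ = π₀ m₀ * ρ m₀ := by rw [Pi.mul_apply]
  rw [hsplit, hrest, hm₀, sum_ite_mem_eq_of_iff (Q := preG (π₀ m₀ * ρ m₀) (P m₀)) (fun a => mem_preG.symm) (d m₀)] at hj
  rw [hsplit, sum_ite_mem_eq_of_iff (Q := preG (π₀ m₀) (P m₀)) (fun a => mem_preG.symm) (d m₀)] at h0
  linarith

/-! ### Counting under a 2-transitive set of tuples: the translates form a 2-design -/

section Design

variable {H : Finset (PermsG n)} {m₀ : Fin r}

/-- **Point counts are constant**: `#{ρ ∈ H | ρ a ∈ Q} = #{ρ ∈ H | ρ b ∈ Q}` for `H` closed under products and inverses and transitive on the slot (bijection `ρ ↦ ρ g`,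
`g b = a`). [cite: DixonMortimer1996, §2.1] -/
theorem card_filter_apply_mem_eq (hmulH : ∀ ρ ∈ H, ∀ ρ' ∈ H, ρ * ρ' ∈ H) (hinvH : ∀ ρ ∈ H, ρ⁻¹ ∈ H) (Q : Finset (Fin (n m₀))) {a b : Fin (n m₀)}
    {g : PermsG n} (hg : g ∈ H) (hgb : g m₀ b = a) :
    (H.filter fun ρ => ρ m₀ a ∈ Q).card = (H.filter fun ρ => ρ m₀ b ∈ Q).card := by
  refine Finset.card_bij (fun ρ _ => ρ * g) (fun ρ hρ => ?_) (fun ρ _ ρ' _ h => mul_right_cancel h) fun ρ' hρ' => ?_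
  · obtain ⟨hρH, hρa⟩ := Finset.mem_filter.1 hρ
    exact Finset.mem_filter.2 ⟨hmulH ρ hρH g hg, by rw [Pi.mul_apply, Equiv.Perm.mul_apply, hgb]; exact hρa⟩
  · obtain ⟨hρ'H, hρ'b⟩ := Finset.mem_filter.1 hρ'
    refine ⟨ρ' * g⁻¹, Finset.mem_filter.2 ⟨hmulH ρ' hρ'H _ (hinvH g hg), ?_⟩, by rw [inv_mul_cancel_right]⟩
    rw [Pi.mul_apply, Pi.inv_apply, Equiv.Perm.mul_apply, ← hgb, Equiv.Perm.inv_def, Equiv.symm_apply_apply]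
    exact hρ'b

/-- **Pair counts are constant**: `#{ρ ∈ H | ρ a ∈ Q, ρ b ∈ Q} = #{ρ ∈ H | ρ a' ∈ Q, ρ b' ∈ Q}` whenever some `g ∈ H` has `g a' = a`, `g b' = b` (e.g. `a ≠ b`, `a' ≠ b'`,
`H` 2-transitive). [cite: DixonMortimer1996, §2.1] -/
theorem card_filter_apply_mem_and_eq (hmulH : ∀ ρ ∈ H, ∀ ρ' ∈ H, ρ * ρ' ∈ H) (hinvH : ∀ ρ ∈ H, ρ⁻¹ ∈ H) (Q : Finset (Fin (n m₀))) {a b a' b' : Fin (n m₀)}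
    {g : PermsG n} (hg : g ∈ H) (hga : g m₀ a' = a) (hgb : g m₀ b' = b) :
    (H.filter fun ρ => ρ m₀ a ∈ Q ∧ ρ m₀ b ∈ Q).card = (H.filter fun ρ => ρ m₀ a' ∈ Q ∧ ρ m₀ b' ∈ Q).card := by
  refine Finset.card_bij (fun ρ _ => ρ * g) (fun ρ hρ => ?_) (fun ρ _ ρ' _ h => mul_right_cancel h) fun ρ' hρ' => ?_
  · obtain ⟨hρH, hρa, hρb⟩ := Finset.mem_filter.1 hρ
    refine Finset.mem_filter.2 ⟨hmulH ρ hρH g hg, ?_, ?_⟩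
    · rw [Pi.mul_apply, Equiv.Perm.mul_apply, hga]; exact hρa
    · rw [Pi.mul_apply, Equiv.Perm.mul_apply, hgb]; exact hρb
  · obtain ⟨hρ'H, hρ'a, hρ'b⟩ := Finset.mem_filter.1 hρ'
    refine ⟨ρ' * g⁻¹, Finset.mem_filter.2 ⟨hmulH ρ' hρ'H _ (hinvH g hg), ?_, ?_⟩, by rw [inv_mul_cancel_right]⟩
    · rw [Pi.mul_apply, Pi.inv_apply, Equiv.Perm.mul_apply, ← hga, Equiv.Perm.inv_def, Equiv.symm_apply_apply]
      exact hρ'a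
    · rw [Pi.mul_apply, Pi.inv_apply, Equiv.Perm.mul_apply, ← hgb, Equiv.Perm.inv_def, Equiv.symm_apply_apply]
      exact hρ'b

/-- The double count: `Σ_{ρ ∈ H, ρ a ∈ Q} Σ_{b : ρ b ∈ Q} f b = Σ_b (#{ρ ∈ H | ρ a ∈ Q, ρ b ∈ Q}) · f b`. [folklore] -/
theorem sum_filter_sum_preG_eq (Q : Finset (Fin (n m₀))) (a : Fin (n m₀)) (f : Fin (n m₀) → ℤ) :
    ∑ ρ ∈ H.filter (fun ρ => ρ m₀ a ∈ Q), ∑ b ∈ preG (ρ m₀) Q, f b =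
      ∑ b : Fin (n m₀), ((H.filter fun ρ => ρ m₀ a ∈ Q ∧ ρ m₀ b ∈ Q).card : ℤ) * f b := by
  classical
  have hinner : ∀ ρ : PermsG n, (∑ b ∈ preG (ρ m₀) Q, f b) = ∑ b : Fin (n m₀), (if ρ m₀ b ∈ Q then f b else 0) := by
    intro ρ
    rw [← Finset.sum_filter]
    refine Finset.sum_congr ?_ fun _ _ => rfl
    ext b
    simp [preG]
  rw [Finset.sum_congr rfl fun ρ _ => hinner ρ, Finset.sum_comm]
  refine Finset.sum_congr rfl fun b _ => ?_
  rw [← Finset.sum_filter, Finset.filter_filter, Finset.sum_const, nsmul_eq_mul]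

/-- **DESIGN SEPARATION.**  `H` a set of tuples closed under products and inverses whose `m₀`-components act 2-TRANSITIVELY on the slot; `σ` any slot permutation; `P` a
position set with `0 < |P| < n m₀`.  If `Σ_{a ∈ (σ ρ_{m₀})⁻¹ P} f` is the same for all `ρ ∈ H` as for `ρ = 1`, then `f` is constant — the translates `ρ_{m₀}⁻¹(σ⁻¹ P)` form
a 2-design with `r > λ`, and `(r − λ)·f(a) = r·c − λ·F` for every point `a`. [cite: DixonMortimer1996, §2.1] -/
theorem sep_of_twoTransitive_translates (hmulH : ∀ ρ ∈ H, ∀ ρ' ∈ H, ρ * ρ' ∈ H) (hinvH : ∀ ρ ∈ H, ρ⁻¹ ∈ H)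
    (h2 : ∀ a b a' b' : Fin (n m₀), a ≠ b → a' ≠ b' → ∃ ρ ∈ H, ρ m₀ a = a' ∧ ρ m₀ b = b')
    (σ : Equiv.Perm (Fin (n m₀))) {P : Finset (Fin (n m₀))} (hP0 : P.Nonempty) (hPn : P.card < n m₀)
    (f : Fin (n m₀) → ℤ) (h : ∀ ρ ∈ H, ∑ a ∈ preG (σ * ρ m₀) P, f a = ∑ a ∈ preG σ P, f a) (a b : Fin (n m₀)) : f a = f b := by
  classical
  -- the base block `Q₀ = σ⁻¹ P`, the translates `ρ_{m₀}⁻¹ Q₀`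
  set Q : Finset (Fin (n m₀)) := preG σ P with hQ
  have hQ0 : Q.Nonempty := by rw [← Finset.card_pos, hQ, card_preG]; exact Finset.card_pos.2 hP0
  have hQn : Q.card < n m₀ := by rw [hQ, card_preG]; exact hPn
  have htrans : ∀ ρ ∈ H, preG (σ * ρ m₀) P = preG (ρ m₀) Q := fun ρ _ => by rw [hQ, preG_mul]
  set c : ℤ := ∑ x ∈ Q, f x with hc
  have hsum : ∀ ρ ∈ H, (∑ x ∈ preG (ρ m₀) Q, f x) = c := fun ρ hρ => by rw [← htrans ρ hρ, h ρ hρ, hc, hQ]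
  -- the slot has at least two points
  have hk2 : 2 ≤ n m₀ := by have := Finset.card_pos.2 hQ0; omega
  haveI : Nontrivial (Fin (n m₀)) := Fin.nontrivial_iff_two_le.2 hk2
  have h1 : ∀ x x' : Fin (n m₀), ∃ ρ ∈ H, ρ m₀ x = x' := fun x x' => by
    obtain ⟨y, hy⟩ := exists_ne x
    obtain ⟨y', hy'⟩ := exists_ne x'
    obtain ⟨ρ, hρ, hρx, -⟩ := h2 x y x' y' hy.symm hy'.symm
    exact ⟨ρ, hρ, hρx⟩
  -- the counts `r` (points) and `λ` (pairs)
  obtain ⟨q₀, hq₀⟩ := hQ0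
  set rr : ℕ := (H.filter fun ρ => ρ m₀ q₀ ∈ Q).card with hrr
  have hr : ∀ x : Fin (n m₀), (H.filter fun ρ => ρ m₀ x ∈ Q).card = rr := fun x => by
    obtain ⟨g, hg, hgx⟩ := h1 q₀ x
    rw [hrr]
    exact card_filter_apply_mem_eq hmulH hinvH Q hg hgx
  obtain ⟨p₀, p₁, hp01, -⟩ : ∃ p₀ p₁ : Fin (n m₀), p₀ ≠ p₁ ∧ True := by
    obtain ⟨y, hy⟩ := exists_ne q₀
    exact ⟨q₀, y, hy.symm, trivial⟩
  set ll : ℕ := (H.filter fun ρ => ρ m₀ p₀ ∈ Q ∧ ρ m₀ p₁ ∈ Q).card with hll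
  have hl : ∀ x y : Fin (n m₀), x ≠ y → (H.filter fun ρ => ρ m₀ x ∈ Q ∧ ρ m₀ y ∈ Q).card = ll := fun x y hxy => by
    obtain ⟨g, hg, hgx, hgy⟩ := h2 p₀ p₁ x y hp01 hxy
    rw [hll]
    exact card_filter_apply_mem_and_eq hmulH hinvH Q hg hgx hgy
  -- `λ < r`: some `ρ` carries `a ↦ q₀ ∈ Q` and `b ↦ q' ∉ Q`
  have hlt : ll < rr := by
    obtain ⟨y, hy⟩ := exists_ne q₀
    have hQu : Q ≠ univ := fun hQu => by
      rw [hQu, Finset.card_univ, Fintype.card_fin] at hQn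
      exact lt_irrefl _ hQn
    obtain ⟨q', -, hq'⟩ := Finset.exists_of_ssubset (Finset.ssubset_univ_iff.2 hQu)
    have hq'q : q₀ ≠ q' := fun h => hq' (h ▸ hq₀)
    obtain ⟨ρ, hρ, hρ0, hρy⟩ := h2 q₀ y q₀ q' hy.symm hq'q
    rw [← hl q₀ y hy.symm, ← hr q₀]
    refine Finset.card_lt_card ⟨fun ρ' hρ' => Finset.mem_filter.2 ⟨(Finset.mem_filter.1 hρ').1, (Finset.mem_filter.1 hρ').2.1⟩, fun hsub => ?_⟩
    have hmem : ρ ∈ H.filter fun ρ => ρ m₀ q₀ ∈ Q := Finset.mem_filter.2 ⟨hρ, by rw [hρ0]; exact hq₀⟩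
    have := (Finset.mem_filter.1 (hsub hmem)).2.2
    rw [hρy] at this
    exact hq' this
  -- the double count at a point `x`: `(r − λ) f x = r c − λ F`
  have key : ∀ x : Fin (n m₀), ((rr : ℤ) - ll) * f x = rr * c - ll * ∑ y : Fin (n m₀), f y := by
    intro x
    have hleft : (∑ ρ ∈ H.filter (fun ρ => ρ m₀ x ∈ Q), ∑ y ∈ preG (ρ m₀) Q, f y) = rr * c := by
      rw [Finset.sum_congr rfl fun ρ hρ => hsum ρ (Finset.mem_filter.1 hρ).1, Finset.sum_const, nsmul_eq_mul, hr x]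
    have hright := sum_filter_sum_preG_eq (H := H) Q x f
    rw [hleft] at hright
    -- split off the term `y = x`
    have hsplit : (∑ y : Fin (n m₀), ((H.filter fun ρ => ρ m₀ x ∈ Q ∧ ρ m₀ y ∈ Q).card : ℤ) * f y) =
        (rr : ℤ) * f x + ∑ y ∈ univ.erase x, (ll : ℤ) * f y := by
      rw [← Finset.add_sum_erase univ _ (Finset.mem_univ x)]
      congr 1
      · have hxx : (H.filter fun ρ => ρ m₀ x ∈ Q ∧ ρ m₀ x ∈ Q) = H.filter fun ρ => ρ m₀ x ∈ Q :=
          Finset.filter_congr fun ρ _ => and_self_iff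
        rw [hxx, hr x]
      · exact Finset.sum_congr rfl fun y hy => by rw [hl x y (Finset.ne_of_mem_erase hy).symm]
    have htot : (∑ y : Fin (n m₀), f y) = f x + ∑ y ∈ univ.erase x, f y := (Finset.add_sum_erase univ f (Finset.mem_univ x)).symm
    rw [hsplit, ← Finset.mul_sum] at hright
    rw [htot]
    linarith
  have hab := key a
  have hba := key b
  have hne : ((rr : ℤ) - ll) ≠ 0 := by omega
  exact mul_left_cancel₀ hne (by rw [hab, hba])

end Design

end Summit.HodgeConjecture.CorCM.Census.MultiFieldWeil
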